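/-
Copyright (c) 2026. All rights reserved.
Released under Apache 2.0 license as described in the file LICENSE.
-/
import Literature.NumberTheory.Automorphic.EichlerOrderAutomorphisms
import Literature.NumberTheory.Automorphic.EichlerOrderTwoSidedIdealsGroupLaw
import Mathlib.Data.Finset.SymmDiff
import HarnessLib

/-!
# Outer automorphisms of an Eichler order: `Aut(O)/Inn(O) ≅ N(O)/ℚ^×O^×` has exponent `2`, is abelian, and the support
# of a composition is the symmetric difference of the supports (Voight Cor. 7.7.4, Lemma 18.5.1, Prop. 18.5.3, (23.4.20))

[tag: quaternion_algebra] [tag: eichler_order] [tag: class_number]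

Topic `NumberTheory/Automorphic`; THEOREMS ONLY (no definition, no named fact, no instance, no notation; net debt `0`).
Lane `lit-hodgefound`, seat p12, gen 54 — sequel of `EichlerOrderAutomorphisms.lean` (`Aut(O) = N(O)/ℚ^×`: an endomorphism
`σ` of `D` with `σ(a) ∈ O ⟺ a ∈ O` is `a ↦ u a u⁻¹` with `u ∈ N(O)`; inner ⟺ `u ∈ ℚ^×O^×`; the support of `σ` is the unique
`s ⊆` primes of `N⁺N⁻` with `O P_{sort s}(O) = (q u) O`) and `EichlerOrderTwoSidedIdealsGroupLaw.lean` (for `x, x' ∈ N(O)`: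
`x² ∈ ℚ^×O^×`, the commutator lies in `O^×`, supports multiply by symmetric difference), for the Eichler order `O` of a
Brandt setup `S : XiSetup N⁺ N⁻`.

THE PRINTED STATEMENTS (J. Voight, *Quaternion Algebras*, GTM 288). Cor. 7.7.4 «`Aut(B) ≃ B^×/F^×`»; Lemma 18.5.1 and
Prop. 18.5.3 «`N_{B^×}(O)/(F^×O^×) ≅ PIdl(O)/PIdl(R)`»; Remark 18.5.6 «`Aut_R(O) = Inn_R(O) = O^×/R^×`» exactly when
`N(O)/F^× ≃ O^×/R^×`; (23.4.20) «`0 → Idl(R) → Idl(O) → ∏_{𝔭 ∣ 𝔑} ℤ/2ℤ → 0`». Hence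
`Out(O) := Aut_ℤ(O)/Inn(O) ≅ N(O)/(ℚ^×O^×) ↪ ∏_{p ∣ N} ℤ/2ℤ` is an elementary abelian `2`-group.

With «`σ` preserves `O`» = `∀ a, σ a ∈ O ↔ a ∈ O` (`σ : D →ₐ[ℚ] D`), «inner» = `∃ w ∈ Stab(O), σ = w · w⁻¹`, this file proves:

* §1 bookkeeping: compositions of `O`-preserving endomorphisms preserve `O`; conjugation by `u u'` is the composition;
  `N(O)` is closed under inverses;
* §2 **EXPONENT 2: `σ ∘ σ` is inner for every `σ ∈ Aut(O)`** (`XiSetup.exists_stabilizer_forall_comp_self_eq_conj`);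
* §3 **ABELIAN: `σ ∘ τ` and `τ ∘ σ` differ by an inner automorphism** — `σ (τ a) = w (τ (σ a)) w⁻¹` with `w ∈ O^×`
  (`XiSetup.exists_stabilizer_forall_comp_eq_conj_comp`);
* §4 **SUPPORTS ARE ADDITIVE: if `s, s'` are supports of `σ, τ` then `s ∆ s'` is a support of `σ ∘ τ`**
  (`XiSetup.support_comp_symmDiff`), hence THE support by uniqueness (`XiSetup.support_comp_eq_symmDiff`); in particular the
  support of `σ ∘ σ` is `∅`.

## References

* [Voight2021] J. Voight, *Quaternion Algebras*, GTM 288 (2021): Cor. 7.7.4, Lemma 18.5.1, Prop. 18.5.3, Remark 18.5.6,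
  18.5.7, (23.4.20).
* [VignerasLNM800] M.-F. Vignéras, *Arithmétique des algèbres de quaternions*, LNM 800 (1980), Ch. I §2 Thm. 2.1, Ch. II §2.

## Scope (honest)

Theorems only; no quotient group `Out(O)` is constructed — «exponent 2» and «abelian» are stated through inner corrections.
-/

noncomputable section

open scoped Pointwise symmDiff

universe u

namespace Literature.NumberTheory.Automorphic

open AtkinLehner

namespace Brandt

variable {Nplus Nminus : ℕ} (S : XiSetup Nplus Nminus)

/-! ## §0 Elementary lemmas -/

/-- The reduced norm of a unit is non-zero. [folklore] -/
private theorem XiSetup.reducedNorm_units_ne_zero₆₃ (u : S.Dˣ) : reducedNorm ℚ S.D (u : S.D) ≠ 0 :=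
  (isUnit_iff_reducedNorm_ne_zero_holds ℚ S.D (u : S.D)).mp u.isUnit

/-- Conjugation by `c u` with `c` central equals conjugation by `u`. [folklore] -/
private theorem conj_eq_conj_of_eq_algebraMap_mul₆₃ {D : Type u} [Ring D] [Algebra ℚ D] {q : ℚ} (hq : q ≠ 0) {u y : Dˣ}
    (hy : (y : D) = algebraMap ℚ D q * u) (a : D) : (y : D) * a * ((y⁻¹ : Dˣ) : D) = u * a * ((u⁻¹ : Dˣ) : D) := by
  have hc : IsUnit (algebraMap ℚ D q) := (IsUnit.mk0 q hq).map _
  have hyu : y = hc.unit * u := Units.ext (by rw [Units.val_mul, hc.unit_spec, hy])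
  have hcinv : ((hc.unit⁻¹ : Dˣ) : D) = algebraMap ℚ D q⁻¹ :=
    Units.inv_eq_of_mul_eq_one_right (by rw [hc.unit_spec, ← map_mul, mul_inv_cancel₀ hq, map_one])
  rw [hyu, mul_inv_rev, Units.val_mul, Units.val_mul, hc.unit_spec, hcinv]
  calc algebraMap ℚ D q * u * a * (((u⁻¹ : Dˣ) : D) * algebraMap ℚ D q⁻¹)
        = algebraMap ℚ D q * (((u : D) * a * ((u⁻¹ : Dˣ) : D)) * algebraMap ℚ D q⁻¹) := by simp only [mul_assoc]
    _ = ((u : D) * a * ((u⁻¹ : Dˣ) : D)) * (algebraMap ℚ D q * algebraMap ℚ D q⁻¹) := by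
          rw [← mul_assoc, Algebra.commutes q ((u : D) * a * ((u⁻¹ : Dˣ) : D)), mul_assoc]
    _ = (u : D) * a * ((u⁻¹ : Dˣ) : D) := by rw [← map_mul, mul_inv_cancel₀ hq, map_one, mul_one]

/-- **Conjugation by a product is the composition of the conjugations**: `(u u') a (u u')⁻¹ = u (u' a u'⁻¹) u⁻¹`. [folklore] -/
private theorem conj_mul₆₃ {D : Type u} [Ring D] (u u' : Dˣ) (a : D) :
    ((u * u' : Dˣ) : D) * a * (((u * u')⁻¹ : Dˣ) : D) = u * ((u' : D) * a * ((u'⁻¹ : Dˣ) : D)) * ((u⁻¹ : Dˣ) : D) := by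
  rw [mul_inv_rev, Units.val_mul, Units.val_mul]
  simp only [mul_assoc]

/-- The increasing enumeration of a set of primes of `N⁺N⁻` is an admissible duplicate-free list. [folklore] -/
private theorem sort_admissible₆₃ {s : Finset ℕ} (hs : s ⊆ (Nplus * Nminus).primeFactors) :
    (∀ r ∈ s.sort (· ≤ ·), r.Prime) ∧ (s.sort (· ≤ ·)).Nodup :=
  ⟨fun _ hr => (Nat.mem_primeFactors.mp (hs ((Finset.mem_sort _).mp hr))).1, Finset.sort_nodup _ _⟩

/-! ## §1 Bookkeeping: compositions, products, inverses -/

/-- **Compositions of `O`-preserving endomorphisms preserve `O`** (`Aut(O)` is closed under composition). [cite: Voight2021, Cor. 7.7.4 and Remark 18.5.6] -/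
theorem XiSetup.comp_mem_iff_of_forall_mem_iff {σ τ : S.D →ₐ[ℚ] S.D} (hσ : ∀ a, σ a ∈ S.O ↔ a ∈ S.O)
    (hτ : ∀ a, τ a ∈ S.O ↔ a ∈ S.O) (a : S.D) : (σ.comp τ) a ∈ S.O ↔ a ∈ S.O := by
  rw [AlgHom.comp_apply, hσ, hτ]

/-- **If `σ = u · u⁻¹` and `τ = u' · u'⁻¹` then `σ ∘ τ = (u u') · (u u')⁻¹`.** [cite: Voight2021, Cor. 7.7.4 (`Aut(B) ≃ B^×/F^×` is a group isomorphism)] -/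
theorem XiSetup.comp_apply_eq_conj_mul {σ τ : S.D →ₐ[ℚ] S.D} {u u' : S.Dˣ} (hσu : ∀ a : S.D, σ a = u * a * ((u⁻¹ : S.Dˣ) : S.D))
    (hτu : ∀ a : S.D, τ a = u' * a * ((u'⁻¹ : S.Dˣ) : S.D)) (a : S.D) :
    (σ.comp τ) a = ((u * u' : S.Dˣ) : S.D) * a * (((u * u')⁻¹ : S.Dˣ) : S.D) := by
  rw [AlgHom.comp_apply, hτu, hσu, conj_mul₆₃]

/-- **`N(O)` is closed under inverses**: `u O u⁻¹ = O ⟹ u⁻¹ O u = O`. [cite: Voight2021, Lemma 18.5.1 (`N_{B^×}(O)` is a group)] -/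
theorem XiSetup.inv_conj_eq_of_conj_eq {u : S.Dˣ} (hu : u • (MulOpposite.op ((u⁻¹ : S.Dˣ) : S.D) • S.O) = S.O) :
    u⁻¹ • (MulOpposite.op ((u⁻¹⁻¹ : S.Dˣ) : S.D) • S.O) = S.O := by
  have key := units_conj_units_conj u u⁻¹ S.O
  rw [hu, inv_mul_cancel, one_conj] at key
  exact key

/-! ## §2 Exponent `2`: the square of an automorphism is inner -/

/-- **`σ ∘ σ` IS INNER FOR EVERY AUTOMORPHISM `σ` OF `O`**: there is a unit `w` of `O` (an element of the stabiliser) with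
`σ(σ(a)) = w a w⁻¹` for all `a ∈ D` — `Out(O) ≅ N(O)/ℚ^×O^×` has exponent `2` (`x² ∈ ℚ^× O^×` for `x ∈ N(O)`, as
`N(O)/ℚ^×O^× ↪ Idl(O)/Idl(ℤ) ≅ ∏_{p ∣ N} ℤ/2ℤ`). [cite: Voight2021, Prop. 18.5.3 with (23.4.20), Remark 18.5.6 and Cor. 7.7.4] -/
theorem XiSetup.exists_stabilizer_forall_comp_self_eq_conj {σ : S.D →ₐ[ℚ] S.D} (hσ : ∀ a, σ a ∈ S.O ↔ a ∈ S.O) :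
    ∃ w ∈ MulAction.stabilizer S.Dˣ S.O, ∀ a : S.D, (σ.comp σ) a = (w : S.D) * a * ((w⁻¹ : S.Dˣ) : S.D) := by
  obtain ⟨u, hu, hσu⟩ := S.exists_conj_eq_and_forall_eq_conj_of_forall_mem_iff σ hσ
  obtain ⟨w, hw, c, hc, hwc⟩ := S.exists_sq_mem_stabilizer_of_conj_eq hu
  refine ⟨w, hw, fun a => ?_⟩
  rw [S.comp_apply_eq_conj_mul hσu hσu]
  exact (conj_eq_conj_of_eq_algebraMap_mul₆₃ hc.ne' (u := u * u) (y := w) (by rw [hwc, Units.val_mul]) a).symm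

/-! ## §3 Abelian: two automorphisms commute up to an inner one -/

/-- **`Out(O)` IS ABELIAN: for automorphisms `σ, τ` of `O` there is a unit `w` of `O` with `σ(τ(a)) = w · τ(σ(a)) · w⁻¹`**
for all `a ∈ D` (the commutator of two normaliser elements lies in `O^×`: `N(O)/O^× ≅ PIdl(O) ≤ Idl(O)` is abelian for an
Eichler order). [cite: Voight2021, Lemma 18.5.1 with (23.4.20) and 18.5.7, Cor. 7.7.4] -/
theorem XiSetup.exists_stabilizer_forall_comp_eq_conj_comp {σ τ : S.D →ₐ[ℚ] S.D} (hσ : ∀ a, σ a ∈ S.O ↔ a ∈ S.O)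
    (hτ : ∀ a, τ a ∈ S.O ↔ a ∈ S.O) :
    ∃ w ∈ MulAction.stabilizer S.Dˣ S.O, ∀ a : S.D, (σ.comp τ) a = (w : S.D) * (τ.comp σ) a * ((w⁻¹ : S.Dˣ) : S.D) := by
  obtain ⟨u, hu, hσu⟩ := S.exists_conj_eq_and_forall_eq_conj_of_forall_mem_iff σ hσ
  obtain ⟨u', hu', hτu⟩ := S.exists_conj_eq_and_forall_eq_conj_of_forall_mem_iff τ hτ
  -- the commutator `(u'⁻¹ u⁻¹)⁻¹ (u⁻¹ u'⁻¹) = u u' u⁻¹ u'⁻¹` of the inverses lies in `Stab(O)`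
  have key := S.commutator_mem_stabilizer_of_conj_eq (S.inv_conj_eq_of_conj_eq hu) (S.inv_conj_eq_of_conj_eq hu')
  rw [mul_inv_rev, inv_inv, inv_inv] at key
  refine ⟨u * u' * (u⁻¹ * u'⁻¹), key, fun a => ?_⟩
  rw [S.comp_apply_eq_conj_mul hσu hτu, S.comp_apply_eq_conj_mul hτu hσu, ← conj_mul₆₃,
    show u * u' * (u⁻¹ * u'⁻¹) * (u' * u) = u * u' by rw [← mul_inv_rev, inv_mul_cancel_right]]

/-! ## §4 The support of a composition is the symmetric difference of the supports -/

/-- **SUPPORTS ADD: if `O P_{sort s}(O) = (q u) O` and `O P_{sort s'}(O) = (q' u') O` with `σ = u · u⁻¹`, `τ = u' · u'⁻¹`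
(`s, s'` supports of `σ, τ`), then `O P_{sort (s ∆ s')}(O) = (q'' u u') O` for some `q'' > 0`, and `σ ∘ τ = (u u') · (u u')⁻¹`:
the symmetric difference `s ∆ s'` is a support of `σ ∘ τ`** — the map `Out(O) ↪ 𝒫(primes of N⁺N⁻)`, `σ ↦ supp σ`, is a
homomorphism into `(𝒫, ∆) ≅ ∏_{p ∣ N} ℤ/2ℤ`. [cite: Voight2021, Prop. 18.5.3 and (23.4.20)] -/
theorem XiSetup.support_comp_symmDiff {σ τ : S.D →ₐ[ℚ] S.D} {u u' y y' : S.Dˣ} {s s' : Finset ℕ} {q q' : ℚ}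
    (hσu : ∀ a : S.D, σ a = u * a * ((u⁻¹ : S.Dˣ) : S.D)) (hτu : ∀ a : S.D, τ a = u' * a * ((u'⁻¹ : S.Dˣ) : S.D))
    (hs : s ⊆ (Nplus * Nminus).primeFactors) (hs' : s' ⊆ (Nplus * Nminus).primeFactors) (hq : 0 < q) (hq' : 0 < q')
    (hy : (y : S.D) = algebraMap ℚ S.D q * u) (hy' : (y' : S.D) = algebraMap ℚ S.D q' * u')
    (h : S.O * S.twoSidedIdealProd S.O (s.sort (· ≤ ·)) = y • S.O) (h' : S.O * S.twoSidedIdealProd S.O (s'.sort (· ≤ ·)) = y' • S.O) :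
    s ∆ s' ⊆ (Nplus * Nminus).primeFactors ∧ (∀ a : S.D, (σ.comp τ) a = ((u * u' : S.Dˣ) : S.D) * a * (((u * u')⁻¹ : S.Dˣ) : S.D)) ∧
      ∃ (q'' : ℚ) (y'' : S.Dˣ), 0 < q'' ∧ (y'' : S.D) = algebraMap ℚ S.D q'' * ((u * u' : S.Dˣ) : S.D) ∧
        S.O * S.twoSidedIdealProd S.O ((s ∆ s').sort (· ≤ ·)) = y'' • S.O := by
  obtain ⟨hl, hnd⟩ := sort_admissible₆₃ hs
  obtain ⟨hl', hnd'⟩ := sort_admissible₆₃ hs'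
  have hsub : s ∆ s' ⊆ (Nplus * Nminus).primeFactors := fun r hr => by
    rcases Finset.mem_symmDiff.mp hr with ⟨h1, -⟩ | ⟨h1, -⟩
    · exact hs h1
    · exact hs' h1
  have hmem : ∀ r, r ∈ (s ∆ s').sort (· ≤ ·) ↔ (r ∈ s.sort (· ≤ ·) ↔ r ∉ s'.sort (· ≤ ·)) := fun r => by
    rw [Finset.mem_sort, Finset.mem_sort, Finset.mem_sort, Finset.mem_symmDiff]
    tauto
  obtain ⟨q'', y'', hq'', hy'', h''⟩ := S.exists_order_mul_twoSidedIdealProd_eq_units_smul_mul hl hnd hl' hnd'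
    (Finset.sort_nodup _ _) hmem hq hq' hy hy' h h'
  exact ⟨hsub, S.comp_apply_eq_conj_mul hσu hτu, q'', y'', hq'', by rw [hy'', Units.val_mul], h''⟩

/-- **THE SUPPORT OF `σ ∘ τ` IS `supp σ ∆ supp τ`**: with `s, s'` supports of `σ, τ` (as above) and `s''` ANY support of
`σ ∘ τ` in the sense of `EichlerOrderAutomorphisms` (some conjugator `v` of `σ ∘ τ`, some `q > 0`, `O P_{sort s''}(O) = (q v) O`),
`s'' = s ∆ s'`. [cite: Voight2021, Prop. 18.5.3 and (23.4.20)] -/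
theorem XiSetup.support_comp_eq_symmDiff {σ τ : S.D →ₐ[ℚ] S.D} (hσ : ∀ a, σ a ∈ S.O ↔ a ∈ S.O) (hτ : ∀ a, τ a ∈ S.O ↔ a ∈ S.O)
    {u u' y y' : S.Dˣ} {s s' : Finset ℕ} {q q' : ℚ}
    (hσu : ∀ a : S.D, σ a = u * a * ((u⁻¹ : S.Dˣ) : S.D)) (hτu : ∀ a : S.D, τ a = u' * a * ((u'⁻¹ : S.Dˣ) : S.D))
    (hs : s ⊆ (Nplus * Nminus).primeFactors) (hs' : s' ⊆ (Nplus * Nminus).primeFactors) (hq : 0 < q) (hq' : 0 < q')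
    (hy : (y : S.D) = algebraMap ℚ S.D q * u) (hy' : (y' : S.D) = algebraMap ℚ S.D q' * u')
    (h : S.O * S.twoSidedIdealProd S.O (s.sort (· ≤ ·)) = y • S.O) (h' : S.O * S.twoSidedIdealProd S.O (s'.sort (· ≤ ·)) = y' • S.O)
    {s'' : Finset ℕ} (hs'' : s'' ⊆ (Nplus * Nminus).primeFactors) {v y'' : S.Dˣ} {q'' : ℚ}
    (hv : ∀ a : S.D, (σ.comp τ) a = v * a * ((v⁻¹ : S.Dˣ) : S.D)) (hq'' : 0 < q'') (hy'' : (y'' : S.D) = algebraMap ℚ S.D q'' * v)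
    (h'' : S.O * S.twoSidedIdealProd S.O (s''.sort (· ≤ ·)) = y'' • S.O) : s'' = s ∆ s' := by
  obtain ⟨hsub, hconj, q₀, y₀, hq₀, hy₀, h₀⟩ := S.support_comp_symmDiff hσu hτu hs hs' hq hq' hy hy' h h'
  exact (S.existsUnique_finset_support_of_forall_mem_iff (σ.comp τ) (S.comp_mem_iff_of_forall_mem_iff hσ hτ)).unique
    ⟨hs'', v, hv, q'', y'', hq'', hy'', h''⟩ ⟨hsub, u * u', hconj, q₀, y₀, hq₀, hy₀, h₀⟩

/-- **The support of `σ ∘ σ` is empty** (`s ∆ s = ∅`), consistent with §2. [cite: Voight2021, Prop. 18.5.3 and (23.4.20)] -/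
theorem XiSetup.support_comp_self_eq_empty {σ : S.D →ₐ[ℚ] S.D} (hσ : ∀ a, σ a ∈ S.O ↔ a ∈ S.O) {u y : S.Dˣ} {s : Finset ℕ}
    {q : ℚ} (hσu : ∀ a : S.D, σ a = u * a * ((u⁻¹ : S.Dˣ) : S.D)) (hs : s ⊆ (Nplus * Nminus).primeFactors) (hq : 0 < q)
    (hy : (y : S.D) = algebraMap ℚ S.D q * u) (h : S.O * S.twoSidedIdealProd S.O (s.sort (· ≤ ·)) = y • S.O)
    {s'' : Finset ℕ} (hs'' : s'' ⊆ (Nplus * Nminus).primeFactors) {v y'' : S.Dˣ} {q'' : ℚ}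
    (hv : ∀ a : S.D, (σ.comp σ) a = v * a * ((v⁻¹ : S.Dˣ) : S.D)) (hq'' : 0 < q'') (hy'' : (y'' : S.D) = algebraMap ℚ S.D q'' * v)
    (h'' : S.O * S.twoSidedIdealProd S.O (s''.sort (· ≤ ·)) = y'' • S.O) : s'' = ∅ := by
  rw [S.support_comp_eq_symmDiff hσ hσ hσu hσu hs hs hq hq hy hy h h hs'' hv hq'' hy'' h'', symmDiff_self]
  rfl

/-- **Supports of `σ ∘ τ` and `τ ∘ σ` coincide** (`s ∆ s' = s' ∆ s`), consistent with §3. [cite: Voight2021, Prop. 18.5.3 and (23.4.20)] -/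
theorem XiSetup.support_comp_comm {σ τ : S.D →ₐ[ℚ] S.D} (hσ : ∀ a, σ a ∈ S.O ↔ a ∈ S.O) (hτ : ∀ a, τ a ∈ S.O ↔ a ∈ S.O)
    {u u' y y' : S.Dˣ} {s s' : Finset ℕ} {q q' : ℚ}
    (hσu : ∀ a : S.D, σ a = u * a * ((u⁻¹ : S.Dˣ) : S.D)) (hτu : ∀ a : S.D, τ a = u' * a * ((u'⁻¹ : S.Dˣ) : S.D))
    (hs : s ⊆ (Nplus * Nminus).primeFactors) (hs' : s' ⊆ (Nplus * Nminus).primeFactors) (hq : 0 < q) (hq' : 0 < q')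
    (hy : (y : S.D) = algebraMap ℚ S.D q * u) (hy' : (y' : S.D) = algebraMap ℚ S.D q' * u')
    (h : S.O * S.twoSidedIdealProd S.O (s.sort (· ≤ ·)) = y • S.O) (h' : S.O * S.twoSidedIdealProd S.O (s'.sort (· ≤ ·)) = y' • S.O)
    {s₁ s₂ : Finset ℕ} (hs₁ : s₁ ⊆ (Nplus * Nminus).primeFactors) (hs₂ : s₂ ⊆ (Nplus * Nminus).primeFactors)
    {v₁ v₂ y₁ y₂ : S.Dˣ} {q₁ q₂ : ℚ}
    (hv₁ : ∀ a : S.D, (σ.comp τ) a = v₁ * a * ((v₁⁻¹ : S.Dˣ) : S.D)) (hq₁ : 0 < q₁) (hy₁ : (y₁ : S.D) = algebraMap ℚ S.D q₁ * v₁)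
    (h₁ : S.O * S.twoSidedIdealProd S.O (s₁.sort (· ≤ ·)) = y₁ • S.O)
    (hv₂ : ∀ a : S.D, (τ.comp σ) a = v₂ * a * ((v₂⁻¹ : S.Dˣ) : S.D)) (hq₂ : 0 < q₂) (hy₂ : (y₂ : S.D) = algebraMap ℚ S.D q₂ * v₂)
    (h₂ : S.O * S.twoSidedIdealProd S.O (s₂.sort (· ≤ ·)) = y₂ • S.O) : s₁ = s₂ := by
  rw [S.support_comp_eq_symmDiff hσ hτ hσu hτu hs hs' hq hq' hy hy' h h' hs₁ hv₁ hq₁ hy₁ h₁,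
    S.support_comp_eq_symmDiff hτ hσ hτu hσu hs' hs hq' hq hy' hy h' h hs₂ hv₂ hq₂ hy₂ h₂, symmDiff_comm]

end Brandt

end Literature.NumberTheory.Automorphic
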